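import Summits.ResolutionOfSingularities.ResolutionOfSingularities.Theses.CleanCovers
import Literature.AlgebraicGeometry.Resolution.NonReducedNoResolution
import Literature.AlgebraicGeometry.Resolution.PrincipalizationToResolution
import Literature.AlgebraicGeometry.Resolution.ProjectiveSpaceRegular

/-!
# `CoverResolution` — negative lemmas II: tools for the `IsFinite` witness (no resolution without
# Noetherianity; gluing a non-resolvable piece)

Support (negative) lemmas for crux `stmt-ResolutionOfSingularities-15104`
(`Summit.ResolutionOfSingularities.ResolutionOfSingularities.Theses.CleanCovers.CoverResolution`),
filed by the standing disprover (cdisprove cycle 1; work file `Cruxes/CoverResolution/Disproof.lean`,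
§4). They are the two GENERIC halves of the proof that the hypothesis `IsFinite f` of the crux is
load-bearing (the concrete witness — the pinch ring glued into `ℙ²` — is the sequel file
`Negative/FalseWithoutIsFinite.lean`, which imports this one). No definitions; no declaration
concludes a route decl.

* `not_hasResolution_Spec_of_forall_pow_dvd` — **no resolution without Noetherianity**: if `O` is a
  domain with a non-unit `v` and an element `u ≠ 0` divisible by every power of `v`, then `Spec O`
  has NO resolution in the sense of `Scheme.HasResolution` (proper, iso over a dense open, regular
  stalks). Proof: the point `η'` over the generic point, a point `x' ∈ cl(η')` over a maximal ideal
  `𝔪 ∋ v` (properness: `π` is closed), the local domain `B = 𝒪_{X',x'}` (regular ⇒ Noetherian),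
  `O → B` injective (generize to `η'`, where `π.stalkMap` is an iso) and local; `u ∈ ⋂ vⁿB ⊆ ⋂ 𝔪_Bⁿ = 0`
  (Krull). The integral, integrally-closed counterpart of `not_hasResolution_spec_dualNumber`.
* `exists_glued_of_not_hasResolution` — **gluing a non-resolvable piece**: for integral `P`, `S_O`,
  open immersions `j₁ : S_A ↪ P`, `j₂ : S_A ↪ S_O` (`S_A ≠ ∅`), `g : S_O → P` with `j₂ ≫ g = j₁`, and
  an open `W ⊆ P` with `g⁻¹(W) ⊆ j₂(S_A)`, the pushout `X = P ⨿_{S_A} S_O` (Mathlib: colimits of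
  locally directed diagrams of open immersions) with `f = 𝟙 ∪ g` is integral, `f` is surjective and
  an open immersion over `W`, and `X` has no resolution as soon as `S_O` has none.

## Sources
* The Stacks Project, Tags 01RN (birational), 02IS (regular schemes), 01JA (gluing schemes).
* H. Matsumura, *Commutative Ring Theory*, Thm. 8.10 (Krull's intersection theorem), Thm. 14.3.
-/

noncomputable section

set_option linter.dupNamespace false -- mandated namespace of this single-conjunct summit

open CategoryTheory CategoryTheory.Limits AlgebraicGeometry
open Literature.AlgebraicGeometry.Resolution Literature.AlgebraicGeometry.Motives

namespace Summit.ResolutionOfSingularities.ResolutionOfSingularities.Theorems.CoverResolution.Negative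

/-! ## The affine core: `Spec` of a domain with a pinch has no resolution -/

/-- **Spec of a domain containing a non-zero element divisible by all powers of a non-unit has no
resolution.** If `O` is a domain, `v ∈ O` a non-unit and `0 ≠ u ∈ ⋂ₙ vⁿO`, then `Spec O` admits no
proper `π : X' → Spec O` which is an isomorphism over a dense open and has regular (stalkwise)
source: take the point `η'` over the generic point, a point `x' ∈ cl(η')` over a maximal ideal
`𝔪 ∋ v` (`π` is closed), and look at `O → B = 𝒪_{X',x'}` (local, and injective because it becomes
`O ⊆ O_{(0)} ≅ 𝒪_{X',η'}` after generization): `u ∈ ⋂ₙ 𝔪_Bⁿ = 0` by Krull's intersection theorem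
in the Noetherian local domain `B`. In particular `Scheme.HasResolution` forces some Noetherianity:
this is the non-finite-type counterpart of `not_hasResolution_spec_dualNumber`. [folklore] -/
theorem not_hasResolution_Spec_of_forall_pow_dvd {O : Type} [CommRing O] [IsDomain O]
    (u v : O) (hu : u ≠ 0) (hv : ¬ IsUnit v) (hdvd : ∀ n : ℕ, v ^ n ∣ u) :
    ¬ Scheme.HasResolution (Spec (.of O)) := by
  rintro ⟨X', π, hπ⟩
  obtain ⟨U, hUd, -, hUiso⟩ := hπ.isBirational
  haveI := hπ.isProper
  haveI := hUiso
  -- the generic point `η` of `Spec O` lies in the dense open `U`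
  let η : ↥(Spec (CommRingCat.of O)) := (⟨⊥, Ideal.isPrime_bot⟩ : PrimeSpectrum O)
  have hηgen : ∀ y : ↥(Spec (CommRingCat.of O)), η ⤳ y := fun y =>
    (PrimeSpectrum.le_iff_specializes η y).mp bot_le
  have hηU : η ∈ U := by
    obtain ⟨y, hy⟩ := hUd.nonempty
    exact U.isOpen.stableUnderGeneralization (hηgen y) hy
  -- the point `η'` of `X'` over `η`
  let e := asIso (π ∣_ U)
  let z : ↥(π ⁻¹ᵁ U) := e.inv.base ⟨η, hηU⟩
  let η' : ↥X' := z.1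
  have hπη' : π.base η' = η := by
    have h1 : (π ∣_ U).base z = ⟨η, hηU⟩ := by
      show (e.inv ≫ e.hom).base ⟨η, hηU⟩ = ⟨η, hηU⟩
      rw [e.inv_hom_id]; rfl
    have h2 := morphismRestrict_base_coe π U z
    rw [h1] at h2
    exact h2.symm
  -- a maximal ideal `M ∋ v`, i.e. a closed point `m` of `V(v)`
  obtain ⟨M, hM, hvM⟩ := Ideal.exists_le_maximal (Ideal.span {v})
    (fun h => hv (Ideal.span_singleton_eq_top.mp h))
  have hvM' : v ∈ M := hvM (Ideal.mem_span_singleton_self v)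
  let m : ↥(Spec (CommRingCat.of O)) := (⟨M, hM.isPrime⟩ : PrimeSpectrum O)
  -- `π` is closed, so some `x'` in the closure of `η'` maps to `m`
  obtain ⟨x', hx'cl, hx'm⟩ : m ∈ π.base '' closure {η'} := by
    have hc : IsClosed (π.base '' closure {η'}) := π.isClosedMap _ isClosed_closure
    have hηm : π.base η' ⤳ m := by rw [hπη']; exact hηgen m
    exact hc.stableUnderSpecialization hηm ⟨η', subset_closure rfl, rfl⟩
  have hspec : η' ⤳ x' := specializes_iff_mem_closure.mpr hx'cl
  -- the stalk `B` at `x'`: a regular, hence Noetherian, local domain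
  haveI hB : IsRegularLocalRing (X'.presheaf.stalk x') := hπ.isRegular x'
  haveI : IsDomain (X'.presheaf.stalk x') := isDomain_of_isRegularLocalRing _
  -- the ring map `ψ : O → B`
  let sO : O →+* Γ(Spec (CommRingCat.of O), ⊤) := (Scheme.ΓSpecIso (CommRingCat.of O)).inv.hom
  let ψ : O →+* X'.presheaf.stalk x' :=
    (X'.presheaf.germ ⊤ x' trivial).hom.comp ((π.appTop).hom.comp sO)
  have hψ : ∀ a, ψ a = X'.presheaf.germ ⊤ x' trivial (π.appTop (sO a)) := fun a => rfl
  -- (i) `ψ v` is not a unit: `v` vanishes at `π x' = m`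
  have hψv : ψ v ∈ IsLocalRing.maximalIdeal (X'.presheaf.stalk x') := by
    rw [IsLocalRing.mem_maximalIdeal, mem_nonunits_iff, hψ]
    intro hunit
    have hx'b : x' ∈ X'.basicOpen (π.appTop (sO v)) := (Scheme.mem_basicOpen_top _ _ _).mpr hunit
    have key : π ⁻¹ᵁ (Spec (CommRingCat.of O)).basicOpen (sO v) = X'.basicOpen (π.appTop (sO v)) :=
      Scheme.preimage_basicOpen π (sO v)
    rw [← key] at hx'b
    have hmb : π.base x' ∈ (Spec (CommRingCat.of O)).basicOpen (sO v) := hx'b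
    have key' : (Spec (CommRingCat.of O)).basicOpen (sO v) = PrimeSpectrum.basicOpen v :=
      basicOpen_eq_of_affine (R := CommRingCat.of O) v
    rw [key', hx'm] at hmb
    exact hmb hvM'
  -- (ii) `ψ` is injective: after generization to `η'` it is `O → O_{(0)} ≅ 𝒪_{X',η'}`
  have hψinj : Function.Injective ψ := by
    intro a b hab
    rw [hψ, hψ] at hab
    have hgen := congrArg (X'.presheaf.stalkSpecializes hspec) hab
    rw [TopCat.Presheaf.germ_stalkSpecializes_apply, TopCat.Presheaf.germ_stalkSpecializes_apply]
      at hgen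
    have key2 : ∀ y : Γ(Spec (CommRingCat.of O), ⊤),
        X'.presheaf.germ ⊤ η' trivial (π.appTop y) =
          π.stalkMap η' ((Spec (CommRingCat.of O)).presheaf.germ ⊤ (π.base η') trivial y) :=
      fun y => (Scheme.Hom.germ_stalkMap_apply π ⊤ η' trivial y).symm
    rw [key2, key2] at hgen
    have hiso : IsIso (π.stalkMap η') :=
      ((MorphismProperty.isomorphisms CommRingCat).arrow_mk_iso_iff
        (morphismRestrictStalkMap π U z)).mp (show IsIso ((π ∣_ U).stalkMap z) from inferInstance)
    have hgen' := (asIso (π.stalkMap η')).commRingCatIsoToRingEquiv.injective hgen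
    have hloc : Function.Injective
        (algebraMap O ((Spec.structureSheaf O).presheaf.stalk (π.base η'))) :=
      IsLocalization.injective (M := (π.base η').asIdeal.primeCompl) _
        (Ideal.primeCompl_le_nonZeroDivisors _)
    exact hloc hgen'
  -- (iii) Krull: `ψ u ∈ ⋂ₙ 𝔪_Bⁿ = 0`
  have hψu : ψ u ∈ (⨅ n : ℕ, IsLocalRing.maximalIdeal (X'.presheaf.stalk x') ^ n) := by
    refine Ideal.mem_iInf.mpr fun n => ?_
    obtain ⟨w, hw⟩ := hdvd n
    rw [hw, map_mul, map_pow]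
    exact Ideal.mul_mem_right _ _ (Ideal.pow_mem_pow hψv n)
  have hbot := Ideal.iInf_pow_eq_bot_of_isDomain (I := IsLocalRing.maximalIdeal (X'.presheaf.stalk x'))
    (IsLocalRing.maximalIdeal.isMaximal _).ne_top
  have h0 : ψ u = 0 := by simpa using hbot.le hψu
  exact hu (hψinj (h0.trans (map_zero ψ).symm))

/-! ## Gluing a non-resolvable affine piece into an integral scheme -/

section Glue

variable {P SO SA : Scheme.{0}} (j₁ : SA ⟶ P) (j₂ : SA ⟶ SO) [IsOpenImmersion j₁] [IsOpenImmersion j₂]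

/-- All maps of a span of open immersions are open immersions (so Mathlib glues it:
`Mathlib/AlgebraicGeometry/Gluing.lean`, locally directed colimits). [folklore] -/
theorem isOpenImmersion_span_map {i j : WalkingSpan} (a : i ⟶ j) :
    IsOpenImmersion ((span j₁ j₂).map a) := by
  match i, j, a with
  | _, _, WidePushoutShape.Hom.id i' =>
    rw [show WidePushoutShape.Hom.id i' = 𝟙 i' from rfl, CategoryTheory.Functor.map_id]
    infer_instance
  | _, _, WidePushoutShape.Hom.init WalkingPair.left =>
    change IsOpenImmersion ((span j₁ j₂).map WalkingSpan.Hom.fst)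
    rw [span_map_fst]; exact ‹IsOpenImmersion j₁›
  | _, _, WidePushoutShape.Hom.init WalkingPair.right =>
    change IsOpenImmersion ((span j₁ j₂).map WalkingSpan.Hom.snd)
    rw [span_map_snd]; exact ‹IsOpenImmersion j₂›

attribute [local instance] isOpenImmersion_span_map

/-- The two legs of the pushout of a span of open immersions are open immersions. [folklore] -/
theorem isOpenImmersion_pushout_inl : IsOpenImmersion (pushout.inl j₁ j₂) :=
  inferInstanceAs (IsOpenImmersion (colimit.ι (span j₁ j₂) WalkingSpan.left))

/-- (second leg) [folklore] -/
theorem isOpenImmersion_pushout_inr : IsOpenImmersion (pushout.inr j₁ j₂) :=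
  inferInstanceAs (IsOpenImmersion (colimit.ι (span j₁ j₂) WalkingSpan.right))

attribute [local instance] isOpenImmersion_pushout_inl isOpenImmersion_pushout_inr

/-- Every point of the pushout comes from one of the two pieces. [folklore] -/
theorem pushout_point_cases (x : ↥(pushout j₁ j₂)) :
    (∃ y, pushout.inl j₁ j₂ y = x) ∨ (∃ q, pushout.inr j₁ j₂ q = x) := by
  obtain ⟨i, xi, h⟩ := Scheme.IsLocallyDirected.ι_jointly_surjective (span j₁ j₂) x
  rcases i with (_ | _ | _)
  · left
    refine ⟨j₁ xi, ?_⟩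
    rw [← h, ← colimit.w (span j₁ j₂) WalkingSpan.Hom.fst, Scheme.Hom.comp_apply]
    rfl
  · left; exact ⟨xi, h⟩
  · right; exact ⟨xi, h⟩

/-- **Gluing a non-resolvable piece.** Let `P`, `S_O` be integral schemes, `S_A` non-empty,
`j₁ : S_A ↪ P`, `j₂ : S_A ↪ S_O` open immersions and `g : S_O → P` with `j₂ ≫ g = j₁`; let `W ⊆ P` be
an open with `g⁻¹(W) ⊆ j₂(S_A)`. Then `X := P ⨿_{S_A} S_O` with `f := 𝟙 ∪ g : X → P` is an INTEGRAL
scheme, `f` is surjective and an open immersion over `W`, and `X` has a resolution only if `S_O`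
has one (resolutions restrict along the open immersion `S_O ↪ X`). [folklore] -/
theorem exists_glued_of_not_hasResolution [IsIntegral P] [IsIntegral SO] [Nonempty ↥SA]
    (g : SO ⟶ P) (hj : j₂ ≫ g = j₁) (W : P.Opens)
    (hW : ∀ q : ↥SO, g q ∈ W → q ∈ Set.range j₂) (hSO : ¬ Scheme.HasResolution SO) :
    ∃ (X : Scheme.{0}) (f : X ⟶ P), IsIntegral X ∧ Function.Surjective f.base ∧
      IsOpenImmersion (f ∣_ W) ∧ ¬ Scheme.HasResolution X := by
  let X : Scheme.{0} := pushout j₁ j₂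
  let ιP : P ⟶ X := pushout.inl j₁ j₂
  let ιO : SO ⟶ X := pushout.inr j₁ j₂
  have hcond : j₁ ≫ ιP = j₂ ≫ ιO := pushout.condition
  let f : X ⟶ P := pushout.desc (𝟙 P) g (by rw [Category.comp_id, hj])
  have hιPf : ιP ≫ f = 𝟙 P := pushout.inl_desc _ _ _
  have hιOf : ιO ≫ f = g := pushout.inr_desc _ _ _
  have hcases : ∀ x : ↥X, (∃ y, ιP y = x) ∨ (∃ q, ιO q = x) := pushout_point_cases j₁ j₂
  refine ⟨X, f, ?_, ?_, ?_, fun h => hSO (Scheme.HasResolution.of_isOpenImmersion ιO h)⟩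
  · -- integral: reduced (covered by reduced pieces) and irreducible (the pieces meet)
    haveI : IsReduced X := by
      refine Scheme.isReduced_of_forall_exists_isOpenImmersion fun x => ?_
      rcases hcases x with ⟨y, rfl⟩ | ⟨q, rfl⟩
      · exact ⟨P, ιP, inferInstance, ⟨y, rfl⟩, inferInstance⟩
      · exact ⟨SO, ιO, inferInstance, ⟨q, rfl⟩, inferInstance⟩
    haveI : IrreducibleSpace ↥X := by
      let U : Bool → Set ↥X := fun b => cond b (Set.range ιP) (Set.range ιO)
      refine ProjectiveSpace.irreducibleSpace_of_iUnion_eq_univ U ?_ ?_ ?_ true ?_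
      · refine Set.eq_univ_of_forall fun x => Set.mem_iUnion.mpr ?_
        rcases hcases x with ⟨y, rfl⟩ | ⟨q, rfl⟩
        · exact ⟨true, y, rfl⟩
        · exact ⟨false, q, rfl⟩
      · rintro (_ | _)
        · exact ιO.isOpenEmbedding.isOpen_range
        · exact ιP.isOpenEmbedding.isOpen_range
      · rintro (_ | _)
        · simpa [U, Set.image_univ] using
            (IrreducibleSpace.isIrreducible_univ ↥SO).image _ ιO.continuous.continuousOn
        · simpa [U, Set.image_univ] using
            (IrreducibleSpace.isIrreducible_univ ↥P).image _ ιP.continuous.continuousOn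
      · rintro (_ | _)
        · obtain ⟨a⟩ : Nonempty ↥SA := inferInstance
          refine ⟨ιO (j₂ a), ⟨j₂ a, rfl⟩, ⟨j₁ a, ?_⟩⟩
          rw [← Scheme.Hom.comp_apply, hcond, Scheme.Hom.comp_apply]
        · obtain ⟨y⟩ : Nonempty ↥P := inferInstance
          exact ⟨ιP y, ⟨y, rfl⟩, ⟨y, rfl⟩⟩
    exact isIntegral_of_irreducibleSpace_of_isReduced _
  · -- surjective
    intro y
    refine ⟨ιP.base y, ?_⟩
    show (ιP ≫ f).base y = y
    rw [hιPf]
    rfl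
  · -- open immersion over `W`: `f⁻¹ W` lies in the piece `P`, where `f` is the identity
    have hrange : Set.range (f ⁻¹ᵁ W).ι.base ⊆ Set.range ιP.base := by
      rintro _ ⟨x, rfl⟩
      have hx : f x.1 ∈ W := x.2
      rcases hcases x.1 with ⟨y, hy⟩ | ⟨q, hq⟩
      · exact ⟨y, hy⟩
      · rw [← hq, ← Scheme.Hom.comp_apply, hιOf] at hx
        obtain ⟨a, ha⟩ := hW q hx
        refine ⟨j₁ a, ?_⟩
        show ιP (j₁ a) = x.1
        rw [← Scheme.Hom.comp_apply, hcond, Scheme.Hom.comp_apply, ha, hq]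
    let l := IsOpenImmersion.lift ιP (f ⁻¹ᵁ W).ι hrange
    have hl : l ≫ ιP = (f ⁻¹ᵁ W).ι := IsOpenImmersion.lift_fac _ _ hrange
    haveI : IsOpenImmersion l := by
      haveI : IsOpenImmersion (l ≫ ιP) := by rw [hl]; infer_instance
      exact IsOpenImmersion.of_comp l ιP
    have hfW : (f ∣_ W) ≫ W.ι = l := by
      rw [morphismRestrict_ι, ← hl, Category.assoc, hιPf, Category.comp_id]
    haveI : IsOpenImmersion ((f ∣_ W) ≫ W.ι) := by rw [hfW]; infer_instance
    exact IsOpenImmersion.of_comp (f ∣_ W) W.ι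

end Glue

end Summit.ResolutionOfSingularities.ResolutionOfSingularities.Theorems.CoverResolution.Negative

end
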